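import Literature.MathematicalPhysics.QuantumFieldTheory.Balaban1983to89.B7Prop1Local

/-!
# `Balaban1983to89.B14.Claim264` — T. Bałaban, *Convergent renormalization expansions for lattice gauge theories*,
# Commun. Math. Phys. **119** (1988) 243–285 [Balaban1988Convergent]: the claim of p. 264 after (3.1), *"the
# restrictions introduced by the characteristic function χ_k imply that the new fields V_{k+1} satisfy the bounds
# |V_{k+1}(∂p′) − 1| < 2L²ε_k for p′ ∈ Γ_k^{(1)}"*, TYPED in printed form and PROVED for the concrete `(k+1)`-fold
# block average (43) of [12] on `ℤ^d` (model instance `B7Prop2Explicit.avgIter`) from the tree's kernel proof of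
# Proposition 2 of [12] (`B7Prop2Explicit`, `B7Prop2SpecialUnitary`, printed locality `B7Prop1Local`)

statement-level skeleton of published theorems with citation tags; proofs where landed; nothing here is a claim
about the Yang–Mills mass gap

PDF held: `paper:balaban1988-cmp119-convergent-renormalization` (journal page = PDF page + 242); pp. 246, 257, 264
(PDF 4, 15, 22) read from the held text AND from the x2 page renders
`pub-balaban/b2b-balaban-ref1/pages/1988-cmp119-convergent-renormalization/…-p015-x2.png`, `…-p022-x2.png` (read as
images: the displays (2.16)–(2.18) and the sentence after (3.1)).  "[12]" = T. Bałaban, *Averaging operations for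
lattice gauge theories*, Commun. Math. Phys. **98** (1985) 17–51 [Balaban1985Averaging] (cell paper B7), Proposition 2
(52)–(54) p. 26, PROVED in the tree for the concrete average (42)/(43) on `ℤ^d`: `B7Prop2Explicit.prop2_explicit`
(gauge groups closed under (42) at radius `1/4`, e.g. `U(N)`), `B7Prop2SpecialUnitary.prop2_explicit_at` (closed at a
radius `t`, e.g. `SU(N)`), `B7Prop1Local.prop2_local_at` (the printed locality "enough to assume (52) for
`p ⊂ B^k(x) ∪ B^k(y) ∪ B^k(z) ∪ B^k(w)`").

WHAT IS REPRODUCED.  SKELETON row `B14.Eq3.1` (mega-formalization `lit-balaban`, HOME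
`run/shared/lean/pub/lit-balaban/`, Phase-2 proof seat `p29` gen 2, unit `lit-balaban-p29`; reader r11's
`ROWS-B14.md`: "(3.1) carrier typed-existing (`Step.DensityRG`) · the Prop-1 consequence: absent (claim by reference,
B7.Prop1)").  This file types and proves that consequence — the `k`-level twin of r11's `B14.Claim246` (p. 246, the
case `k = 0`: "Proposition 1 [12] implies that the new field V satisfies the bound |V(∂p′) − 1| < 2L²ε₀").

THE PRINTED TEXT.  p. 264 (verbatim, render p022): *"Using the inductive assumption we write
(Tρ_k)(V_{k+1}) = Σ_{{Ω_j},{Λ_j}} ∫dV_k δ(V̄_kV_{k+1}⁻¹) χ_k T_k exp A_k, (3.1) and next we consider one term on the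
right-hand side. Notice that the restrictions ontroduced [sic] by the characteristic function χ_k imply that the new
fields V_{k+1} satisfy the bounds |V_{k+1}(∂p′) − 1| < 2L²ε_k for p′ ∈ Γ_k^{(1)}."*  The ingredients (p. 257, render
p015): *"U_{k,□}(V_k) = U(𝐁_k(□^{~4}), M˙(Q_k^{s*}V_k)), (2.16) where Q_k^{s*}V_k is defined as in (1.3), only
1-blocks are replaced by k-blocks"*; *"χ_k(Ω_k) = Π_{□⊂Ω_k} χ({sup_{p⊂□~} |U_{k,□}(V_k, ∂p) − 1| < ε_kη²}), (2.17)
where the cubes □ belong to the partition of the lattice T_η into cubes of the size LM₂R_k"*; `η = L^{−k}` (p. 244);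
`Γ_k = Ω_k` ((2.2) p. 255); `V̄_k` = the one-step average (42) of [12] of the unit-lattice field `V_k`, and the
`δ(V̄_kV_{k+1}⁻¹)` of (3.1) makes `V_{k+1} = V̄_k` on the `L`-lattice `T_L^{(k+1)}` (before the rescaling to the unit
lattice); `M˙(Q_k^{s*}V_k)` prescribes the `k`-fold averages of `U_{k,□}(V_k)` on the `k`-blocks over `□^{~4}`:
`M^k(U_{k,□}(V_k)) = V_k` there ((1.3) p. 246: `(Q^{s*}V)(b) = V(c)` for `b ∈ B(c)`; (2.12)–(2.13) p. 256: `U(𝐁, V)` is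
the minimizer under the constraint `M_𝐁(U) = V`).

THE ARGUMENT FORMALISED (print: a one-line claim by reference; the p. 246 sentence names "Proposition 1 [12]", at
level `k` it is Proposition 2 of [12] = Proposition 1 iterated `k+1` times).  On the `η`-plaquettes `p ⊂ □~` the
configuration `U := U_{k,□}(V_k)` satisfies (2.17), `|U(∂p) − 1| < ε_kη² = ε_kL^{−2k} = (L²ε_k)·(L^{−(k+1)})²`
(`bound217_eq`), i.e. the hypothesis (52) of Prop. 2 of [12] for `k+1` averaging steps with `α₀ = L²ε_k`; and
`V_{k+1} = V̄_k = \overline{M^k(U)} = M^{k+1}(U)` (43).  Hence (54): `|V_{k+1}(∂p′) − 1| = |M^{k+1}(U)(∂p′) − 1| <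
α₀ + 2C₀α₀² < 2α₀ = 2L²ε_k` for `C₀α₀ ≤ ⅓`, `2α₀ ≤ c₂′` — EXACTLY the printed `2L²ε_k`.  PROVED HERE (kernel; axioms
`propext`, `Classical.choice`, `Quot.sound`): §1 the arithmetic; §2 the explicit form for any gauge group
`G ⊂ {|u| ≤ 1, |u⁻¹| ≤ 1}` closed under (42) at a radius `t` (`B7Prop2SpecialUnitary.AvgClosedAt`); §3 the printed
form `Claim264Printed` (unitary configurations, `U(N) ⊂ M_N(ℂ)` included) and `Claim264Printed_holds`; §4 the printed
locality ("for `p ⊂ □~`" / "`p′ ∈ Γ_k^{(1)}`": (2.17) only on the four `(k+1)`-blocks at the corners of `p′`); §5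
`SU(N)`.

MODEL / DECLARED DEVIATIONS (referee columns F6/F7; those of `B7Prop2Explicit` (b)–(e) are inherited).
(M1) LATTICE: `T_η`, `η = L^{−k}`, is read on `ℤ^d` (`U(x, κ) = U(⟨ηx, η(x + e_κ)⟩)`, `B7Prop2Explicit` DICTIONARY:
no torus, no subdomain); `M^j = avgIter L · j` (each step = (42) followed by `Lℤ^d ≅ ℤ^d`); the `L`-lattice
plaquette variables `V_{k+1}(∂p′) = M^{k+1}(U)(∂p′)` are `hol (avgIter L U (k+1)) z (plaqWord μ ν)` and
`sup_{p′} |V_{k+1}(∂p′) − 1|` is `pdev (avgIter L U (k+1))`.  (M2) The two tacit identifications of the print —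
`U := U_{k,□}(V_k)` has `M^k(U) = V_k` on `□^{~4}` (the constraint in (2.16)) and `V_{k+1} = V̄_k` (the `δ` of (3.1))
— are the DICTIONARY, not hypotheses: the theorems are stated for an arbitrary `G`-valued `U` on `ηℤ^d` and conclude
on `M^{k+1}(U)`; they apply verbatim to `U = U_{k,□}(V_k)` (the minimizer of [15] = B11 Thm 1, row `B14.Eq2.16`,
typed abstractly in the tree).  (M3) LOCALITY: (2.17) is printed cube by cube, "sup over `p ⊂ □~`"; §§2–3 assume it
for ALL plaquettes of `ηℤ^d` (strict bound on the supremum `pdev`, the form (52) has in `B7Prop2Explicit`); §4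
(`claim264_local_at`, `claim264_local_unitary`) only on the `η`-plaquettes inside the four `(k+1)`-blocks
`B^{k+1}(·)` at the corners of `p′` (`B7Prop1Local.pdevOn (loK L (k+1) z) (plaqHiK L (k+1) z μ ν)`), which lie in
`□~` whenever `p′ ⊂ □` up to one `L`-layer — the printed locality of Prop. 2 of [12]; the set `Γ_k^{(1)}` itself
(the `L`-sublattice points of `Ω_k`) is thus rendered plaquette by plaquette.  (M4) SMALLNESS: print has every
constant "for `g_k` [hence `ε_k = g_kp₀(g_k)`, (2.4)] sufficiently small", `L` fixed first; here explicitly, with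
`α₀ = L²ε_k`: `C₀(d)·L²ε_k ≤ ⅓`, `2L²ε_k ≤ c₂′(d, L) = 1/(512(d+1)(d+4)L²)`, for a general `G` the closure radius
`32(d+1)(d+4)L²·L²ε_k ≤ t`; in `Claim264Printed` all three are implied by ONE displayed threshold `L⁴ε_k ≤ c`,
`c = 1/(3C₀(d)) = 1/(43392(d+1)²(d+4)²)` chosen before `L`, `k`, `ε_k` (`smallness_of_L4`).  (M5) GAUGE GROUP: print
"a Lie subgroup `G` of `U(N)`"; the bound is proved for any `G` closed under (42) at some radius (`U(N)`: the unitary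
group of a C⋆-algebra, radius `1/4`; `SU(N)`: `Nt < π`, §5); `Claim264Printed` is stated for unitary-valued
configurations in a non-trivial C⋆-algebra (`M_N(ℂ)`, operator norm, included), which covers every `G ⊂ U(N)` as far
as the BOUND is concerned.  (M6) `k ≥ 0` arbitrary (`k = 0` is the p. 246 sentence, there from Prop. 1 for
`{|u| ≤ 1, |u⁻¹| ≤ 1}`-valued fields with (1.1) on `Δ(p′)` — r11's `B14.Claim246.Claim246Printed_holds`; not
re-derived); `L ≥ 2` ([12] p. 17 "`L > 1`").  Net new unproved facts: 0 (`Claim264Printed` is discharged here).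
-/

open scoped BigOperators
open NormedSpace Finset

namespace Literature.MathematicalPhysics.QuantumFieldTheory.Balaban1983to89.B14.Claim264

open B7Prop1Explicit B7Prop2Explicit B7Prop2SpecialUnitary B7Prop1Local MatrixLog

-- `Site` alone could resolve to the torus sites of `Setup.lean` through a parent namespace; re-export the `ℤ^d`
-- sites `Fin d → ℤ` of `B7Prop1Explicit` (the convention of `B14.Claim246`, `B14Hyp313Discharge`).
export B7Prop1Explicit (Site)

variable {d : ℕ}

/-! ## §1 Bookkeeping: (2.17) is (52) of [12] for `k+1` steps with `α₀ = L²ε_k`; the smallness -/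

/-- **(2.17) is (52) of [12] for `k+1` averaging steps with `α₀ = L²ε_k`:** `ε_kη² = ε_kL^{−2k} = L²ε_k·(L^{−(k+1)})²`.
[cite: Balaban1988Convergent, (2.17) p.257, p.264 (after (3.1))] -/
theorem bound217_eq (L : ℕ) (hL : L ≠ 0) (k : ℕ) (εk : ℝ) :
    εk * (((L : ℝ) ^ k)⁻¹) ^ 2 = (L : ℝ) ^ 2 * εk * (((L : ℝ) ^ (k + 1))⁻¹) ^ 2 := by
  have hL' : (L : ℝ) ≠ 0 := by exact_mod_cast hL
  field_simp
  ring

/-- **One displayed threshold for "ε_k sufficiently small"** (M4): `L⁴ε_k ≤ 1/(3C₀(d))`, `L ≥ 1` ⟹ with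
`α₀ = L²ε_k` the three smallness conditions of Prop. 2 of [12] hold: `C₀α₀ ≤ ⅓`, `2α₀ ≤ c₂′(d, L)`, and the
closure-radius condition `32(d+1)(d+4)L²α₀ ≤ 1/4` of a gauge group closed at radius `1/4` (e.g. `U(N)`).
[cite: Balaban1988Convergent, p.264 (after (3.1)); (2.4) p.255] -/
theorem smallness_of_L4 {L : ℕ} (hL : 1 ≤ L) {εk : ℝ} (hε : 0 ≤ εk)
    (h : (L : ℝ) ^ 4 * εk ≤ 1 / (3 * C0 d)) :
    C0 d * ((L : ℝ) ^ 2 * εk) ≤ 1 / 3 ∧ 2 * ((L : ℝ) ^ 2 * εk) ≤ c2' d L ∧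
      32 * ((d : ℝ) + 1) * (d + 4) * (L : ℝ) ^ 2 * ((L : ℝ) ^ 2 * εk) ≤ 1 / 4 := by
  have hLr : (1 : ℝ) ≤ L := by exact_mod_cast hL
  have hC := C0_pos d
  have hd0 : (0 : ℝ) ≤ d := Nat.cast_nonneg d
  have hL2 : (1 : ℝ) ≤ (L : ℝ) ^ 2 := one_le_pow₀ hLr
  -- `C₀ L⁴ ε_k ≤ 1/3`
  have h1 : C0 d * ((L : ℝ) ^ 4 * εk) ≤ 1 / 3 := by
    have := mul_le_mul_of_nonneg_left h hC.le
    rwa [show C0 d * (1 / (3 * C0 d)) = 1 / 3 by field_simp] at this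
  have hL24 : (L : ℝ) ^ 2 * εk ≤ (L : ℝ) ^ 4 * εk := by
    have : (L : ℝ) ^ 2 ≤ (L : ℝ) ^ 4 := by nlinarith
    exact mul_le_mul_of_nonneg_right this hε
  have hA : C0 d * ((L : ℝ) ^ 2 * εk) ≤ 1 / 3 := (mul_le_mul_of_nonneg_left hL24 hC.le).trans h1
  -- `2L²ε_k ≤ c₂′ = 1/(512(d+1)(d+4)L²)` ⟸ `1024(d+1)(d+4)L⁴ε_k ≤ 1` ⟸ `1024(d+1)(d+4) ≤ 3C₀ = 43392(d+1)²(d+4)²`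
  have hpos : (0 : ℝ) < 512 * ((d : ℝ) + 1) * (d + 4) * (L : ℝ) ^ 2 := by positivity
  have hK : 1024 * ((d : ℝ) + 1) * (d + 4) ≤ C0 d := by
    unfold C0; nlinarith [sq_nonneg ((d : ℝ) + 1), sq_nonneg ((d : ℝ) + 4), mul_nonneg hd0 hd0]
  have hB' : 1024 * ((d : ℝ) + 1) * (d + 4) * ((L : ℝ) ^ 4 * εk) ≤ 1 / 3 :=
    (mul_le_mul_of_nonneg_right hK (by positivity)).trans h1
  have hB : 2 * ((L : ℝ) ^ 2 * εk) ≤ c2' d L := by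
    unfold c2'
    rw [le_div_iff₀ hpos]
    have : 2 * ((L : ℝ) ^ 2 * εk) * (512 * ((d : ℝ) + 1) * (d + 4) * (L : ℝ) ^ 2)
        = 1024 * ((d : ℝ) + 1) * (d + 4) * ((L : ℝ) ^ 4 * εk) := by ring
    rw [this]; linarith
  refine ⟨hA, hB, ?_⟩
  -- `32(d+1)(d+4)L²α₀ = 16(d+1)(d+4)L²·(2α₀) ≤ 16(d+1)(d+4)L²·c₂′ = 1/32 ≤ 1/4`
  have hB2 := hB
  unfold c2' at hB2
  rw [le_div_iff₀ hpos] at hB2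
  nlinarith [hB2]

section Core

variable {𝔸 : Type*} [NormedRing 𝔸] [NormOneClass 𝔸] [NormedAlgebra ℂ 𝔸] [CompleteSpace 𝔸]

/-! ## §2 The claim for a gauge group closed under (42) at radius `t`, explicit smallness -/

/-- **p. 264, "χ_k ⇒ |V_{k+1}(∂p′) − 1| < 2L²ε_k", explicit form** (Prop. 2 (54) of [12] for `k+1` steps,
`prop2_explicit_at`): for `L ≥ 2`, a gauge group `G ⊂ {|u| ≤ 1, |u⁻¹| ≤ 1}` closed under (42) at radius `t`, a
`G`-valued configuration `U` (= `U_{k,□}(V_k)`) on `ηℤ^d ≅ ℤ^d`, `η = L^{−k}`, with (2.17) `sup_p |U(∂p) − 1| < ε_kη²`,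
and the smallness `C₀L²ε_k ≤ ⅓`, `2L²ε_k ≤ c₂′`, `32(d+1)(d+4)L²·L²ε_k ≤ t`: the `(k+1)`-fold average
`V_{k+1} = M^{k+1}(U)` has `sup_{p′} |V_{k+1}(∂p′) − 1| < L²ε_k + 2C₀(L²ε_k)²`, and every `M^j(U)`, `j ≤ k+1`, is
`G`-valued. [cite: Balaban1988Convergent, p.264 (after (3.1)); (2.17) p.257] -/
theorem claim264_explicit (L : ℕ) (hL : 2 ≤ L) {G : Subgroup 𝔸ˣ} {t : ℝ} (hG : AvgClosedAt d t L G) (k : ℕ)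
    (U : Site d → Fin d → 𝔸ˣ) (hU : ∀ x κ, U x κ ∈ G) {εk : ℝ} (hε : 0 < εk)
    (hC : C0 d * ((L : ℝ) ^ 2 * εk) ≤ 1 / 3) (hc2' : 2 * ((L : ℝ) ^ 2 * εk) ≤ c2' d L)
    (ht : 32 * ((d : ℝ) + 1) * (d + 4) * (L : ℝ) ^ 2 * ((L : ℝ) ^ 2 * εk) ≤ t)
    (h217 : pdev U < εk * (((L : ℝ) ^ k)⁻¹) ^ 2) :
    pdev (avgIter L U (k + 1)) < (L : ℝ) ^ 2 * εk + 2 * C0 d * ((L : ℝ) ^ 2 * εk) ^ 2 ∧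
      ∀ j ≤ k + 1, ∀ x κ, avgIter L U j x κ ∈ G := by
  have hLr : (0 : ℝ) < L := by exact_mod_cast lt_of_lt_of_le (by norm_num) hL
  have hα : 0 < (L : ℝ) ^ 2 * εk := by positivity
  rw [bound217_eq L (by omega) k εk] at h217
  exact prop2_explicit_at L hL hG (k + 1) U hU hα hC hc2' ht h217

/-- **p. 264, the printed bound `2L²ε_k`:** under the hypotheses of `claim264_explicit`,
`sup_{p′} |V_{k+1}(∂p′) − 1| < 2L²ε_k` (the last inequality of (54) of [12], `α₀ + 2C₀α₀² < 2α₀` for `C₀α₀ ≤ ⅓`).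
[cite: Balaban1988Convergent, p.264 (after (3.1))] -/
theorem claim264_explicit_lt_two (L : ℕ) (hL : 2 ≤ L) {G : Subgroup 𝔸ˣ} {t : ℝ} (hG : AvgClosedAt d t L G)
    (k : ℕ) (U : Site d → Fin d → 𝔸ˣ) (hU : ∀ x κ, U x κ ∈ G) {εk : ℝ} (hε : 0 < εk)
    (hC : C0 d * ((L : ℝ) ^ 2 * εk) ≤ 1 / 3) (hc2' : 2 * ((L : ℝ) ^ 2 * εk) ≤ c2' d L)
    (ht : 32 * ((d : ℝ) + 1) * (d + 4) * (L : ℝ) ^ 2 * ((L : ℝ) ^ 2 * εk) ≤ t)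
    (h217 : pdev U < εk * (((L : ℝ) ^ k)⁻¹) ^ 2) :
    pdev (avgIter L U (k + 1)) < 2 * (L : ℝ) ^ 2 * εk := by
  have hLr : (0 : ℝ) < L := by exact_mod_cast lt_of_lt_of_le (by norm_num) hL
  have hα : 0 < (L : ℝ) ^ 2 * εk := by positivity
  have h := (claim264_explicit L hL hG k U hU hε hC hc2' ht h217).1
  have h2 := B7.prop2_bound_lt_two_alpha (C0 d) ((L : ℝ) ^ 2 * εk) hα hC
  linarith

/-- **The bound at a single plaquette `p′` of the `L`-lattice `T_L^{(k+1)}`** (lower-left corner `z`, directions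
`μ, ν`, in `(k+1)`-lattice coordinates): `|V_{k+1}(∂p′) − 1| < 2L²ε_k`, and `V_{k+1}` is `G`-valued — the form in
which the sentence is used ("We introduce new restrictions on these fields"). [cite: Balaban1988Convergent, p.264 (after (3.1))] -/
theorem claim264_explicit_plaq (L : ℕ) (hL : 2 ≤ L) {G : Subgroup 𝔸ˣ} {t : ℝ} (hG : AvgClosedAt d t L G)
    (k : ℕ) (U : Site d → Fin d → 𝔸ˣ) (hU : ∀ x κ, U x κ ∈ G) {εk : ℝ} (hε : 0 < εk)
    (hC : C0 d * ((L : ℝ) ^ 2 * εk) ≤ 1 / 3) (hc2' : 2 * ((L : ℝ) ^ 2 * εk) ≤ c2' d L)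
    (ht : 32 * ((d : ℝ) + 1) * (d + 4) * (L : ℝ) ^ 2 * ((L : ℝ) ^ 2 * εk) ≤ t)
    (h217 : pdev U < εk * (((L : ℝ) ^ k)⁻¹) ^ 2) (z : Site d) (μ ν : Fin d) :
    ‖((hol (avgIter L U (k + 1)) z (plaqWord μ ν) : 𝔸ˣ) : 𝔸) - 1‖ < 2 * (L : ℝ) ^ 2 * εk ∧
      ∀ x κ, avgIter L U (k + 1) x κ ∈ G := by
  have hmem := (claim264_explicit L hL hG k U hU hε hC hc2' ht h217).2 (k + 1) le_rfl
  have hU1 : ∀ x κ, avgIter L U (k + 1) x κ ∈ U1 𝔸 := fun x κ => hG.le_U1 (hmem x κ)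
  exact ⟨(le_pdev hU1 z μ ν).trans_lt (claim264_explicit_lt_two L hL hG k U hU hε hC hc2' ht h217), hmem⟩

end Core

/-! ## §3 The printed claim, typed and proved (unitary configurations; `G = U(N) ⊂ M_N(ℂ)` included) -/

section Printed

/-- **B14 p. 264 (verbatim): *"Notice that the restrictions [i]ntroduced by the characteristic function χ_k imply
that the new fields V_{k+1} satisfy the bounds |V_{k+1}(∂p′) − 1| < 2L²ε_k for p′ ∈ Γ_k^{(1)}."*** — printed form
over the concrete `(k+1)`-fold average (43) of [12] on `ℤ^d`: there is `c > 0` (depending on `d` only; the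
"ε_k small" of the paper, M4) such that for every block side `L ≥ 2`, every level `k`, every `ε_k > 0` with
`L⁴ε_k ≤ c`, and every unitary-valued configuration `U` (= `U_{k,□}(V_k)`, (2.16)) on `T_η ≅ ℤ^d`, `η = L^{−k}`,
satisfying the restriction of `χ_k` (2.17) `sup_p |U(∂p) − 1| < ε_kη²`, the new field `V_{k+1} = V̄_k = M^{k+1}(U)`
satisfies `sup_{p′} |V_{k+1}(∂p′) − 1| < 2L²ε_k`.  (Model notes M1–M6 of the file header: `ℤ^d` for the torus,
(2.17) on all plaquettes — the printed locality is `claim264_local_unitary` —, unitary group of a non-trivial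
C⋆-algebra for "`G ⊂ U(N)`".) [cite: Balaban1988Convergent, p.264 (after (3.1)); (2.17) p.257] -/
def Claim264Printed (d : ℕ) (𝔸 : Type*) [CStarAlgebra 𝔸] [Nontrivial 𝔸] : Prop :=
  ∃ c : ℝ, 0 < c ∧ ∀ L : ℕ, 2 ≤ L → ∀ k : ℕ, ∀ εk : ℝ, 0 < εk → (L : ℝ) ^ 4 * εk ≤ c →
    ∀ (U : Site d → Fin d → 𝔸ˣ), (∀ x κ, U x κ ∈ unitaryUnits 𝔸) →
      pdev U < εk * (((L : ℝ) ^ k)⁻¹) ^ 2 →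
        pdev (avgIter L U (k + 1)) < 2 * (L : ℝ) ^ 2 * εk

variable {𝔸 : Type*} [CStarAlgebra 𝔸] [Nontrivial 𝔸]

/-- **p. 264 for unitary configurations, explicit smallness:** `claim264_explicit_lt_two` for the unitary group of a
non-trivial C⋆-algebra (`B7Prop2Explicit.avgClosed_unitaryUnits`, radius `1/4`), the closure-radius condition being
implied by `2L²ε_k ≤ c₂′`; also every `M^j(U)`, `j ≤ k+1`, is unitary. [cite: Balaban1988Convergent, p.264 (after (3.1))] -/
theorem claim264_unitary (L : ℕ) (hL : 2 ≤ L) (k : ℕ) (U : Site d → Fin d → 𝔸ˣ)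
    (hU : ∀ x κ, U x κ ∈ unitaryUnits 𝔸) {εk : ℝ} (hε : 0 < εk)
    (hC : C0 d * ((L : ℝ) ^ 2 * εk) ≤ 1 / 3) (hc2' : 2 * ((L : ℝ) ^ 2 * εk) ≤ c2' d L)
    (h217 : pdev U < εk * (((L : ℝ) ^ k)⁻¹) ^ 2) :
    pdev (avgIter L U (k + 1)) < 2 * (L : ℝ) ^ 2 * εk ∧
      ∀ j ≤ k + 1, ∀ x κ, avgIter L U j x κ ∈ unitaryUnits 𝔸 := by
  have hL1 : (1 : ℝ) ≤ L := by exact_mod_cast le_trans (by norm_num) hL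
  have hpos : (0 : ℝ) < 512 * ((d : ℝ) + 1) * (d + 4) * (L : ℝ) ^ 2 := by positivity
  -- the closure radius `1/4` of the unitary group: `32(d+1)(d+4)L²α₀ = 16(d+1)(d+4)L²(2α₀) ≤ 1/32 ≤ 1/4`
  have ht : 32 * ((d : ℝ) + 1) * (d + 4) * (L : ℝ) ^ 2 * ((L : ℝ) ^ 2 * εk) ≤ 1 / 4 := by
    have h1 : 2 * ((L : ℝ) ^ 2 * εk) ≤ 1 / (512 * ((d : ℝ) + 1) * (d + 4) * (L : ℝ) ^ 2) := hc2'
    rw [le_div_iff₀ hpos] at h1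
    nlinarith [h1]
  have hG := avgClosedAt_of_avgClosed (avgClosed_unitaryUnits d L (𝔸 := 𝔸)) (le_refl (1 / 4 : ℝ))
  exact ⟨claim264_explicit_lt_two L hL hG k U hU hε hC hc2' ht h217,
    (claim264_explicit L hL hG k U hU hε hC hc2' ht h217).2⟩

variable (d 𝔸) in
/-- **`Claim264Printed` HOLDS**, with `c = 1/(3C₀(d)) = 1/(43392(d+1)²(d+4)²)`, by Proposition 2 of [12] for the
concrete `(k+1)`-fold average (`claim264_unitary`) and the arithmetic `smallness_of_L4`.
[cite: Balaban1988Convergent, p.264 (after (3.1))] -/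
theorem Claim264Printed_holds : Claim264Printed d 𝔸 := by
  refine ⟨1 / (3 * C0 d), by have := C0_pos d; positivity, ?_⟩
  intro L hL k εk hε hsmall U hU h217
  have hL1 : 1 ≤ L := le_trans (by norm_num) hL
  obtain ⟨hC, hc2', -⟩ := smallness_of_L4 (d := d) hL1 hε.le hsmall
  exact (claim264_unitary L hL k U hU hε hC hc2' h217).1

end Printed

/-! ## §4 The printed locality: (2.17) only "for `p ⊂ □~`" — here on the four `(k+1)`-blocks at the corners of `p′`
([12] p. 26: "enough to assume (52) for `p ⊂ B^k(x) ∪ B^k(y) ∪ B^k(z) ∪ B^k(w)`"; tree `B7Prop1Local.prop2_local_at`) -/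

section Local

variable {𝔸 : Type*} [NormedRing 𝔸] [NormOneClass 𝔸] [NormedAlgebra ℂ 𝔸] [CompleteSpace 𝔸]

/-- **p. 264 WITH THE PRINTED LOCALITY**, for a gauge group closed at radius `t`: for a plaquette `p′` of the
`L`-lattice `T_L^{(k+1)}` (lower-left corner `z`, directions `μ ≠ ν` or not, in `(k+1)`-lattice coordinates), if
(2.17) `|U(∂p) − 1| < ε_kη²` holds (as a strict bound on the supremum) for the `η`-plaquettes `p` inside the four
`(k+1)`-blocks `B^{k+1}(·)` at the corners of `p′` ONLY (`pdevOn (loK L (k+1) z) (plaqHiK L (k+1) z μ ν)`; these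
blocks lie in `□~` for `p′` at an `L`-lattice point of `□ ⊂ Γ_k = Ω_k`), then `|V_{k+1}(∂p′) − 1| =
|M^{k+1}(U)(∂p′) − 1| < 2L²ε_k`. [cite: Balaban1988Convergent, p.264 (after (3.1)); (2.17) p.257] -/
theorem claim264_local_at (L : ℕ) (hL : 2 ≤ L) {G : Subgroup 𝔸ˣ} {t : ℝ} (hG : AvgClosedAt d t L G) (k : ℕ)
    (U : Site d → Fin d → 𝔸ˣ) (hU : ∀ x κ, U x κ ∈ G) {εk : ℝ} (hε : 0 < εk)
    (hC : C0 d * ((L : ℝ) ^ 2 * εk) ≤ 1 / 3) (hc2' : 2 * ((L : ℝ) ^ 2 * εk) ≤ c2' d L)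
    (ht : 32 * ((d : ℝ) + 1) * (d + 4) * (L : ℝ) ^ 2 * ((L : ℝ) ^ 2 * εk) ≤ t) (z : Site d) (μ ν : Fin d)
    (h217 : pdevOn (loK L (k + 1) z) (plaqHiK L (k + 1) z μ ν) U < εk * (((L : ℝ) ^ k)⁻¹) ^ 2) :
    ‖((hol (avgIter L U (k + 1)) z (plaqWord μ ν) : 𝔸ˣ) : 𝔸) - 1‖ < 2 * (L : ℝ) ^ 2 * εk := by
  have hLr : (0 : ℝ) < L := by exact_mod_cast lt_of_lt_of_le (by norm_num) hL
  have hα : 0 < (L : ℝ) ^ 2 * εk := by positivity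
  rw [bound217_eq L (by omega) k εk] at h217
  have h := prop2_local_at L hL hG (k + 1) U hU hα hC hc2' ht z μ ν h217
  have h2 := B7.prop2_bound_lt_two_alpha (C0 d) ((L : ℝ) ^ 2 * εk) hα hC
  linarith

end Local

section LocalUnitary

variable {𝔸 : Type*} [CStarAlgebra 𝔸] [Nontrivial 𝔸]

/-- **p. 264 with the printed locality for unitary configurations** (`G` = the unitary group of a non-trivial
C⋆-algebra, `U(N) ⊂ M_N(ℂ)` with the operator norm included): `claim264_local_at` with the closure radius `1/4`
discharged by `2L²ε_k ≤ c₂′`. [cite: Balaban1988Convergent, p.264 (after (3.1))] -/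
theorem claim264_local_unitary (L : ℕ) (hL : 2 ≤ L) (k : ℕ) (U : Site d → Fin d → 𝔸ˣ)
    (hU : ∀ x κ, U x κ ∈ unitaryUnits 𝔸) {εk : ℝ} (hε : 0 < εk)
    (hC : C0 d * ((L : ℝ) ^ 2 * εk) ≤ 1 / 3) (hc2' : 2 * ((L : ℝ) ^ 2 * εk) ≤ c2' d L) (z : Site d)
    (μ ν : Fin d)
    (h217 : pdevOn (loK L (k + 1) z) (plaqHiK L (k + 1) z μ ν) U < εk * (((L : ℝ) ^ k)⁻¹) ^ 2) :
    ‖((hol (avgIter L U (k + 1)) z (plaqWord μ ν) : 𝔸ˣ) : 𝔸) - 1‖ < 2 * (L : ℝ) ^ 2 * εk := by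
  have hL1 : (1 : ℝ) ≤ L := by exact_mod_cast le_trans (by norm_num) hL
  have hpos : (0 : ℝ) < 512 * ((d : ℝ) + 1) * (d + 4) * (L : ℝ) ^ 2 := by positivity
  have ht : 32 * ((d : ℝ) + 1) * (d + 4) * (L : ℝ) ^ 2 * ((L : ℝ) ^ 2 * εk) ≤ 1 / 4 := by
    have h1 : 2 * ((L : ℝ) ^ 2 * εk) ≤ 1 / (512 * ((d : ℝ) + 1) * (d + 4) * (L : ℝ) ^ 2) := hc2'
    rw [le_div_iff₀ hpos] at h1
    nlinarith [h1]
  have hG := avgClosedAt_of_avgClosed (avgClosed_unitaryUnits d L (𝔸 := 𝔸)) (le_refl (1 / 4 : ℝ))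
  exact claim264_local_at L hL hG k U hU hε hC hc2' ht z μ ν h217

end LocalUnitary

/-! ## §5 The paper's "Lie subgroup `G` of `U(N)`" for `G = SU(N) ⊂ M_N(ℂ)` (operator norm) -/

section SpecialUnitary

variable {n : Type*} [Fintype n] [DecidableEq n] [Nonempty n]

open scoped Matrix.Norms.L2Operator

/-- **p. 264 for `SU(N)`-valued configurations** (`B7Prop2SpecialUnitary.avgClosedAt_specialUnitary`): the explicit
smallness of `claim264_explicit` plus the one `G`-dependent condition `N·32(d+1)(d+4)L²·L²ε_k < π` ⟹
`sup_{p′} |V_{k+1}(∂p′) − 1| < 2L²ε_k` and every `M^j(U)`, `j ≤ k+1`, is `SU(N)`-valued.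
[cite: Balaban1988Convergent, p.264 (after (3.1))] -/
theorem claim264_specialUnitary (L : ℕ) (hL : 2 ≤ L) (k : ℕ) (U : Site d → Fin d → (Matrix n n ℂ)ˣ)
    (hU : ∀ x κ, U x κ ∈ specialUnitaryUnits n) {εk : ℝ} (hε : 0 < εk)
    (hC : C0 d * ((L : ℝ) ^ 2 * εk) ≤ 1 / 3) (hc2' : 2 * ((L : ℝ) ^ 2 * εk) ≤ c2' d L)
    (hN : Fintype.card n * (32 * ((d : ℝ) + 1) * (d + 4) * (L : ℝ) ^ 2 * ((L : ℝ) ^ 2 * εk)) < Real.pi)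
    (h217 : pdev U < εk * (((L : ℝ) ^ k)⁻¹) ^ 2) :
    pdev (avgIter L U (k + 1)) < 2 * (L : ℝ) ^ 2 * εk ∧
      ∀ j ≤ k + 1, ∀ x κ, avgIter L U j x κ ∈ specialUnitaryUnits n := by
  letI : CStarAlgebra (Matrix n n ℂ) := {}
  have hL1 : (1 : ℝ) ≤ L := by exact_mod_cast le_trans (by norm_num) hL
  have hpos : (0 : ℝ) < 512 * ((d : ℝ) + 1) * (d + 4) * (L : ℝ) ^ 2 := by positivity
  have ht4 : 32 * ((d : ℝ) + 1) * (d + 4) * (L : ℝ) ^ 2 * ((L : ℝ) ^ 2 * εk) ≤ 1 / 4 := by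
    have h1 : 2 * ((L : ℝ) ^ 2 * εk) ≤ 1 / (512 * ((d : ℝ) + 1) * (d + 4) * (L : ℝ) ^ 2) := hc2'
    rw [le_div_iff₀ hpos] at h1
    nlinarith [h1]
  have hG := avgClosedAt_specialUnitary d L ht4 hN
  exact ⟨claim264_explicit_lt_two L hL hG k U hU hε hC hc2' le_rfl h217,
    (claim264_explicit L hL hG k U hU hε hC hc2' le_rfl h217).2⟩

end SpecialUnitary

-- Axiom audit (scratch, not shipped): `#print axioms` of `Claim264Printed_holds`, `claim264_local_unitary`,
-- `claim264_specialUnitary` = [propext, Classical.choice, Quot.sound].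

end Literature.MathematicalPhysics.QuantumFieldTheory.Balaban1983to89.B14.Claim264
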